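import Mathlib.Topology.Algebra.OpenSubgroup
import Mathlib.Topology.MetricSpace.Ultra.TotallySeparated
import Mathlib.NumberTheory.Padics.ProperSpace
import Mathlib.NumberTheory.Padics.RingHoms
import Literature.AnabelianGeometry.AbsoluteAnabelian.AbsTopII.EllipticAdmissibleFiniteObstruction
import HarnessLib

/-!
# `ℤ_l` tools for the pro-`Σ` clause of [AbsTopII] Def 3.1 (c): hereditary pro-`Σ`, and the `p`-th power map

S. Mochizuki, *Topics in Absolute Anabelian Geometry II* [AbsTopII], Definition 3.1 (c) p. 65 (manuscript
pagination `paper:url-585b8d0ad0d9`; bib key `MochizukiAbsTopII2013`): "for every set of primes `Σ` such that some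
open subgroup of `Δ` is pro-`Σ`, it holds that `Δ` is pro-`Σ`".  PROOF-ONLY tools (no definitions), by-name
complements of `AbsTopII/EllipticAdmissibleFiniteObstruction.lean` (`isProSigmaGroup_padicInt_iff`: `ℤ_l` is
pro-`Σ` iff `l ∈ Σ`) and of the tree's `isFreeProSigmaCyclic_singleton_padicInt` (the indices of open subgroups of
`ℤ_l` are exactly the powers of `l`), for seats building `ℤ_l`-models of the typed hypothesis structures
(abc-iut-w4-d071's 2-adic model `EllipticAdmissibleNonVacuity.lean` proves the case `l = 2` of both inline):

* `mem_of_isProSigmaGroup_of_isOpen_padicInt` — the HEREDITARY form: if some OPEN subgroup of `ℤ_l` is pro-`Σ`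
  (for its subspace topology) then `l ∈ Σ`; i.e. the hypothesis "some open subgroup of `Δ` is pro-`Σ`" of Def 3.1 (c)
  at `Δ ≅ ℤ_l` holds EXACTLY for the `Σ ∋ l` (`exists_isOpen_isProSigmaGroup_padicInt_iff`);
* `padicInt_powMonoidHom` — the `p`-th power map of `ℤ_p` (multiplicatively; additively `x ↦ p·x`) is injective with
  OPEN image of index `p` (the kernel of `ℤ_p ↠ ℤ/p`): the "finite étale degree-`p` self-covering" of such models.

Classical facts about `ℤ_l` [cite: RibesZalesskii2010, Thm 2.7.1]; nothing here bears on, or takes a side on,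
[IUTchIII] Cor 3.12; typed ≠ proved.
-/

noncomputable section

open Topology

namespace Literature.AnabelianGeometry.AbsoluteAnabelian.AbsTopII

open Literature.AnabelianGeometry.Anabelioids (IsSigmaInteger)

/-- HEREDITARY form: if some OPEN subgroup `K` of `ℤ_l` is pro-`Σ` (for its subspace topology), then
`l ∈ Σ` — `K` has the open subgroup `K ∩ L`, `L` open of index `l·[ℤ_l : K]`, whose index in `K` is a
(positive) multiple of `l`.  This is the hypothesis "some open subgroup of `Δ` is pro-`Σ`" of
[AbsTopII] Def 3.1 (c) evaluated at `Δ = ℤ_l`. [cite: MochizukiAbsTopII2013, Def 3.1 (c) p.65] -/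
theorem mem_of_isProSigmaGroup_of_isOpen_padicInt (l : ℕ) [hl : Fact l.Prime] {S : Set ℕ}
    (K : Subgroup (Multiplicative ℤ_[l])) (hKo : IsOpen (K : Set (Multiplicative ℤ_[l])))
    (hK : IsProSigmaGroup S K) : l ∈ S := by
  have hZ := isFreeProSigmaCyclic_singleton_padicInt l
  have hlp : l.Prime := hl.out
  -- the index of `K` is a power of `l`
  have hKi : IsSigmaInteger {l} K.index := (hZ.isOpen_index_iff K.index).1 ⟨K, hKo, rfl⟩
  -- an open subgroup `L` of index `l · [ℤ_l : K]`
  have hlK : IsSigmaInteger {l} (l * K.index) := by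
    refine ⟨Nat.mul_pos hlp.pos hKi.1, fun p hp hdvd => ?_⟩
    rcases (Nat.Prime.dvd_mul hp).1 hdvd with h | h
    · exact Set.mem_singleton_iff.2 ((Nat.prime_dvd_prime_iff_eq hp hlp).1 h)
    · exact hKi.2 p hp h
  obtain ⟨L, hLo, hLi⟩ := (hZ.isOpen_index_iff (l * K.index)).2 hlK
  -- `N := L ∩ K ≤ K` is open, normal (abelian), of finite index a multiple of `l`
  have hNo : IsOpen ((L.subgroupOf K : Subgroup K) : Set K) := by
    rw [Subgroup.coe_subgroupOf]
    exact hLo.preimage continuous_subtype_val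
  have hLK : (L ⊓ K).index ≠ 0 := by
    haveI : Finite (Multiplicative ℤ_[l] ⧸ (L ⊓ K)) :=
      Subgroup.quotient_finite_of_isOpen _ (hLo.inter hKo)
    haveI : (L ⊓ K).FiniteIndex := Subgroup.finiteIndex_of_finite_quotient
    exact Subgroup.FiniteIndex.index_ne_zero
  have hmul : L.relIndex K * K.index = (L ⊓ K).index := by
    rw [← Subgroup.inf_relIndex_right]
    exact Subgroup.relIndex_mul_index inf_le_right
  have hrel0 : L.relIndex K ≠ 0 := by
    intro h0
    rw [h0, zero_mul] at hmul
    exact hLK hmul.symm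
  have hdvd : l ∣ L.relIndex K := by
    have h1 : L.index ∣ (L ⊓ K).index := Subgroup.index_dvd_of_le inf_le_left
    rw [hLi, ← hmul] at h1
    exact Nat.dvd_of_mul_dvd_mul_right hKi.1 h1
  haveI : (L.subgroupOf K).FiniteIndex := ⟨hrel0⟩
  have hint := hK.index_isSigmaInteger (L.subgroupOf K) (Subgroup.normal_of_isMulCommutative _) hNo
    inferInstance
  exact hint.2 l hlp hdvd

/-- The `p`-th power map of `ℤ_p` (multiplicatively; additively: multiplication by `p`) is injective,
and its image `pℤ_p` is an OPEN subgroup of index `p` (the kernel of the reduction `ℤ_p ↠ ℤ/p`).  For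
`p = 2` this is the "finite étale double covering `D → C`" of the model below.
[cite: RibesZalesskii2010, Thm 2.7.1] -/
theorem padicInt_powMonoidHom (p : ℕ) [hp : Fact p.Prime] :
    Function.Injective (powMonoidHom p : Multiplicative ℤ_[p] →* Multiplicative ℤ_[p]) ∧
      IsOpen (((powMonoidHom p : Multiplicative ℤ_[p] →* Multiplicative ℤ_[p]).range :
        Subgroup (Multiplicative ℤ_[p])) : Set (Multiplicative ℤ_[p])) ∧
      ((powMonoidHom p : Multiplicative ℤ_[p] →* Multiplicative ℤ_[p]).range).index = p := by
  have hp0 : (p : ℤ_[p]) ≠ 0 := (Nat.cast_ne_zero (R := ℤ_[p])).2 hp.out.ne_zero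
  -- the kernel of the reduction mod `p`, additively
  let K₀ : AddSubgroup ℤ_[p] := (PadicInt.toZMod (p := p)).toAddMonoidHom.ker
  have hmemK₀ : ∀ x : ℤ_[p], x ∈ K₀ ↔ (p : ℤ_[p]) ∣ x := by
    intro x
    change PadicInt.toZMod x = 0 ↔ _
    rw [← RingHom.mem_ker, PadicInt.ker_toZMod, PadicInt.maximalIdeal_eq_span_p,
      Ideal.mem_span_singleton]
  -- the range of the `p`-th power map is `K₀`
  have hrange : (powMonoidHom p : Multiplicative ℤ_[p] →* Multiplicative ℤ_[p]).range =
      K₀.toSubgroup := by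
    ext x
    rw [Multiplicative.mem_toSubgroup, hmemK₀, MonoidHom.mem_range]
    constructor
    · rintro ⟨y, rfl⟩
      refine ⟨Multiplicative.toAdd y, ?_⟩
      rw [powMonoidHom_apply, toAdd_pow, nsmul_eq_mul]
    · rintro ⟨c, hc⟩
      refine ⟨Multiplicative.ofAdd c, ?_⟩
      apply Multiplicative.toAdd.injective
      rw [powMonoidHom_apply, toAdd_pow, toAdd_ofAdd, nsmul_eq_mul, hc]
  refine ⟨?_, ?_, ?_⟩
  · intro x y hxy
    have h := congrArg Multiplicative.toAdd hxy
    rw [powMonoidHom_apply, powMonoidHom_apply, toAdd_pow, toAdd_pow, nsmul_eq_mul,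
      nsmul_eq_mul] at h
    exact Multiplicative.toAdd.injective (mul_left_cancel₀ hp0 h)
  · -- `K₀ ⊇ {‖x‖ < 1}`, an open neighbourhood of `0`
    have hK₀o : IsOpen (K₀ : Set ℤ_[p]) := by
      apply AddSubgroup.isOpen_of_mem_nhds (g := 0)
      refine Filter.mem_of_superset (Metric.isOpen_ball.mem_nhds (Metric.mem_ball_self one_pos)) ?_
      intro x hx
      rw [Metric.mem_ball, dist_zero_right, PadicInt.norm_lt_one_iff_dvd] at hx
      exact (hmemK₀ x).2 hx
    rw [hrange]
    change IsOpen (Multiplicative.toAdd ⁻¹' (K₀ : Set ℤ_[p]))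
    exact hK₀o.preimage continuous_toAdd
  · have hsurj : Function.Surjective (PadicInt.toZMod (p := p)).toAddMonoidHom :=
      ZMod.ringHom_surjective (PadicInt.toZMod (p := p))
    rw [hrange, AddSubgroup.index_toSubgroup]
    change (PadicInt.toZMod (p := p)).toAddMonoidHom.ker.index = p
    rw [AddSubgroup.index_ker, AddMonoidHom.range_eq_top.mpr hsurj, AddSubgroup.card_top,
      Nat.card_zmod]


/-- At `Δ ≅ ℤ_l` the hypothesis of [AbsTopII] Def 3.1 (c) — "some open subgroup of `Δ` is pro-`Σ`" — holds iff
`l ∈ Σ` (⇐: `ℤ_l` itself). [cite: MochizukiAbsTopII2013, Def 3.1 (c) p.65] -/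
theorem exists_isOpen_isProSigmaGroup_padicInt_iff (l : ℕ) [Fact l.Prime] {S : Set ℕ} :
    (∃ K : Subgroup (Multiplicative ℤ_[l]), IsOpen (K : Set (Multiplicative ℤ_[l])) ∧ IsProSigmaGroup S K) ↔
      l ∈ S := by
  constructor
  · rintro ⟨K, hKo, hK⟩
    exact mem_of_isProSigmaGroup_of_isOpen_padicInt l K hKo hK
  · intro hl
    refine ⟨⊤, by rw [Subgroup.coe_top]; exact isOpen_univ, ?_⟩
    -- `⊤ ≃ ℤ_l` as topological groups
    let e : Multiplicative ℤ_[l] ≃ₜ* ↥(⊤ : Subgroup (Multiplicative ℤ_[l])) :=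
      { (Subgroup.topEquiv : (⊤ : Subgroup (Multiplicative ℤ_[l])) ≃* Multiplicative ℤ_[l]).symm with
        continuous_toFun := by
          show Continuous fun x : Multiplicative ℤ_[l] =>
            (⟨x, Subgroup.mem_top x⟩ : ↥(⊤ : Subgroup (Multiplicative ℤ_[l])))
          exact continuous_id.subtype_mk _
        continuous_invFun := by
          show Continuous fun x : ↥(⊤ : Subgroup (Multiplicative ℤ_[l])) => (x : Multiplicative ℤ_[l])
          exact continuous_subtype_val }
    exact ((isProSigmaGroup_padicInt_iff l).2 hl).of_continuousMulEquiv e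

end Literature.AnabelianGeometry.AbsoluteAnabelian.AbsTopII
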